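import Summits.HubbardSuperconductivity.HubbardSuperconductivity.Theorems.InfiniteVolumeFirstNoNormalLimitStateThermalWindowChord
import HarnessLib

/-!
# Crux `NoInfraredPileUp` (stmt-HubbardSuperconductivity-18534, route `InfiniteVolumeFirst`) —
# the THERMAL REWARD CHORD: tightness of every ground state from two sector partition functions

Crux r3 `NoInfraredPileUp` asks, at weak coupling, that EVERY normalised sector ground state `ψ_L`
of `hubbardTorus 2 L 1 U` have a tight `d`-wave pair structure factor:
`Σ_{m ≠ 0, |q_m| ≤ ε} S_{ψ_L}(m) ≤ η L²` eventually in even `L`. Two features make it hard to SUPPLY: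
the ground-state clause is load-bearing (`Theorems/NoInfraredPileUp/Negative/AllSectorStates`: false
for general sector states) and its near-ground-state strengthening is false in any `O(1)` energy window
once there is weak-coupling LRO (`Negative/NearGroundStates`: a phase-twisted condensate sits at
`|q| = 2π/L`). This module gives the crux an ENGINE-FACING sufficient condition that is blind to the
degeneracy of the ground multiplet and lives strictly between those two statements — the mirror image,
with a REWARD in place of a penalty, of the thermal re-cut of crux r2
(`InfiniteVolumeFirstNoNormalLimitStateThermalWindowChord`). With the open-window operator
`W'_ε = Σ_{m ≠ 0, |q_m| ≤ ε} L⁻² Δ_d(m)ᴴ Δ_d(m)` and `A := −W'_ε` in the tree's one-vector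
Peierls–Bogoliubov inequality with an entropy budget (`Theorems.thermalChord_le_re_rayleigh`):

* `openWindowReward_isHermitian`, `re_expect_openWindowReward` — `W'_ε` is Hermitian and
  `re ⟨ψ, W'_ε ψ⟩ = Σ_{m ≠ 0, |q_m| ≤ ε} S_ψ(m)` (sector preservation is in the companion module);
* `windowCeiling_of_thermalRewardChord` — ONE SIDE, ONE `β`: if the reward `−λ W'_ε` raises the sector
  log-partition function by at most `β λ η L² − L² log 4`,
  `log re tr (P_K e^{-β(H − λW'_ε)}) − log re tr (P_K e^{-βH}) + L² log 4 ≤ β λ (η L²)`, then EVERY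
  normalised ground state of `H` in `K = szSector (2n) 0` has `Σ_{m ≠ 0, |q_m| ≤ ε} S_ψ(m) ≤ η L²`;
* `stub_thermalRewardChordTransfer` — THE EDGE: that chord for every `δ`, all `U < U₁(δ)`, every `η`,
  some `ε` and all large even `L` (with `λ = λ(L) > 0`, `β = β(L) > 0` free) implies `NoInfraredPileUp`;
* `windowCeiling_of_rewardStability`, `stub_rewardStabilityTransfer` — the `T = 0` version: reward
  STABILITY of the sector ground-state energy, `minEnergyOn H K − minEnergyOn (H − λ W'_ε) K ≤ λ (η L²)`,
  bounds the open-window weight of every ground state (plain chord inequality), hence gives the crux;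
* companion module `InfiniteVolumeFirstNoInfraredPileUpThermalRewardChordOfStability`: the thermal
  hypothesis asks NO MORE than `T = 0` reward stability (strict `T = 0` chord ⇒ thermal chord for any
  Hermitian sector-preserving observable): reward stability ⇒ thermal reward chord ⇒ crux.

SCALING (what a supplier must respect). The reward must be INTENSIVE, `λ = κ₀/L²`: for an extensive
reward the phase-twisted condensate of `Negative/NearGroundStates` (excitation energy `O(ρ_s)`, window
weight `≈ n₀ L²`) wins and both hypotheses are false as soon as `η < n₀`; with `λ = κ₀/L²` and `κ₀`
below the stiffness scale they are the natural engine statements (the entropy budget then forces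
`β ≳ L² log 4/(κ₀ η)`, i.e. `β ≍ L²`, where the Gibbs weight of the twisted states is `e^{-O(β)}`).
Nothing here supplies the chord: it needs control of the pair susceptibility of the EXACT weak-coupling
ground multiplet at wavelength `L` (the twist wall of `Cruxes/NoInfraredPileUp/STRATEGY-CENSUS.md`).
Pure finite-dimensional algebra over landed lemmas; no definition and no named fact is introduced.
Sources: B. Simon, *The Statistical Mechanics of Lattice Gases* I (1993) §II.13; Bratteli–Robinson II
§5.3.1; Tasaki (2020) App. A, §2.1; Pitaevskii–Stringari, J. Low Temp. Phys. 85 (1991) 377;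
Koma–Tasaki, PRL 68 (1992) 3248.
-/

noncomputable section

-- the mandated namespace `Summit.<Summit>.<Problem>.Theorems` repeats `HubbardSuperconductivity`
-- (single-problem summit, D-0017), which the `dupNamespace` linter flags on every declaration
set_option linter.dupNamespace false

namespace Summit.HubbardSuperconductivity.HubbardSuperconductivity.Theorems.NoInfraredPileUp

open Literature.MathematicalPhysics.QuantumLattice Literature.Probability.LatticeModels Matrix Finset
  Filter
open Summit.HubbardSuperconductivity.HubbardSuperconductivity.Theses
open scoped ComplexConjugate ComplexOrder Topology

/-! ### The open-window reward operator `W'_ε` -/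

/-- The open-window operator `W'_ε = Σ_{m ≠ 0, |q_m| ≤ ε} L⁻² Δ_d(m)ᴴ Δ_d(m)` is Hermitian. [folklore] -/
theorem openWindowReward_isHermitian (L : ℕ) [NeZero L] (ε : ℝ) :
    (∑ m : Fin 2 → ZMod L, if m ≠ 0 ∧ momentumNormSq L m ≤ ε ^ 2 then
        ((L : ℂ) ^ 2)⁻¹ • ((pairFieldAt dWaveFormFactor L m)ᴴ * pairFieldAt dWaveFormFactor L m)
        else 0).IsHermitian := by
  unfold Matrix.IsHermitian
  rw [conjTranspose_sum]
  refine Finset.sum_congr rfl fun m _ => ?_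
  split_ifs with hm
  · rw [conjTranspose_smul, conjTranspose_mul, conjTranspose_conjTranspose]
    congr 1
    rw [Complex.star_def, map_inv₀, map_pow, Complex.conj_natCast]
  · exact conjTranspose_zero

/-- **The open-window reward in a state**: `re ⟨ψ, W'_ε ψ⟩ = Σ_{m ≠ 0, |q_m| ≤ ε} S_ψ(m)` — the
left-hand side of the crux's inequality is the expectation of `W'_ε`. [folklore] -/
theorem re_expect_openWindowReward (L : ℕ) [NeZero L] (ε : ℝ) (ψ : Fock (Orb (FermionTorus 2 L))) :
    (star ψ ⬝ᵥ (∑ m : Fin 2 → ZMod L, if m ≠ 0 ∧ momentumNormSq L m ≤ ε ^ 2 then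
        ((L : ℂ) ^ 2)⁻¹ • ((pairFieldAt dWaveFormFactor L m)ᴴ * pairFieldAt dWaveFormFactor L m)
        else 0) *ᵥ ψ).re =
      ∑ m : Fin 2 → ZMod L, if m ≠ 0 ∧ momentumNormSq L m ≤ ε ^ 2 then
        pairStructureFactor dWaveFormFactor L ψ m else 0 := by
  rw [sum_mulVec, dotProduct_sum, Complex.re_sum]
  refine Finset.sum_congr rfl fun m _ => ?_
  split_ifs with hm
  · rw [smul_mulVec, dotProduct_smul, smul_eq_mul,
      ← Literature.MathematicalPhysics.QuantumLattice.star_mulVec_dotProduct_mulVec,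
      pairStructureFactor_apply,
      show ((L : ℂ) ^ 2)⁻¹ = ((((L : ℝ) ^ 2)⁻¹ : ℝ) : ℂ) by push_cast; rfl, Complex.re_ofReal_mul,
      div_eq_inv_mul]
  · rw [zero_mulVec, dotProduct_zero, Complex.zero_re]

/-! ### One side, one `β`: the thermal reward chord bounds the open-window weight of EVERY ground state -/

/-- **Every sector ground state is tight, from a thermal reward chord.** Side `L ≥ 1`, coupling `U`,
window radius `ε`, strengths `λ, β > 0`, sector `K = szSector (2n) 0` with orthogonal projection `P_K`,
`H = hubbardTorus 2 L 1 U`, `W'_ε` the open-window operator. If the REWARD `−λ W'_ε` raises the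
sector log-partition function by at most `β λ η L² − L² log 4`, i.e.
`log re tr (P_K e^{-β(H − λ W'_ε)}) − log re tr (P_K e^{-βH}) + L² log 4 ≤ β λ (η L²)`, then every
normalised ground state `ψ` of `H` in `K` has `Σ_{m ≠ 0, |q_m| ≤ ε} S_ψ(m) ≤ η L²`: the one-vector
Peierls–Bogoliubov inequality `re tr (P_K e^{-β(H − λW')}) ≥ e^{-β(e₀ − λ re⟨ψ,W'ψ⟩)}` against the
entropy budget `re tr (P_K e^{-βH}) ≤ 4^{L²} e^{-β e₀}` (`Theorems.thermalChord_le_re_rayleigh` with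
`A = −W'_ε`, `Theorems.finrank_szSector_fermionTorus_le`) and `re_expect_openWindowReward`.
Degeneracy-blind: no gap, no genericity, no `β → ∞`. B. Simon (1993) §II.13; Tasaki (2020) App. A.
[folklore] -/
theorem windowCeiling_of_thermalRewardChord (L : ℕ) [NeZero L] (U ε : ℝ) {lam β η : ℝ}
    (hlam : 0 < lam) (hβ : 0 < β) (n : ℕ) {ψ : Fock (Orb (FermionTorus 2 L))}
    (hψ1 : star ψ ⬝ᵥ ψ = 1) (hψ : IsGroundStateInSector (hubbardTorus 2 L 1 U) (2 * n) 0 ψ)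
    (hchord : Real.log (projMatrix ((szSector (Λ := FermionTorus 2 L) (2 * n) 0).map
          (Fock.toEuclidean (ι := Orb (FermionTorus 2 L)) :
            Fock (Orb (FermionTorus 2 L)) →ₗ[ℂ] EuclideanSpace ℂ (Finset (Orb (FermionTorus 2 L))))) *
          gibbsWeight β (hubbardTorus 2 L 1 U - (lam : ℂ) • ∑ m : Fin 2 → ZMod L,
            if m ≠ 0 ∧ momentumNormSq L m ≤ ε ^ 2 then
              ((L : ℂ) ^ 2)⁻¹ • ((pairFieldAt dWaveFormFactor L m)ᴴ * pairFieldAt dWaveFormFactor L m)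
            else 0)).trace.re -
        Real.log (projMatrix ((szSector (Λ := FermionTorus 2 L) (2 * n) 0).map
          (Fock.toEuclidean (ι := Orb (FermionTorus 2 L)) :
            Fock (Orb (FermionTorus 2 L)) →ₗ[ℂ] EuclideanSpace ℂ (Finset (Orb (FermionTorus 2 L))))) *
          gibbsWeight β (hubbardTorus 2 L 1 U)).trace.re +
        (L : ℝ) ^ 2 * Real.log 4 ≤ β * lam * (η * (L : ℝ) ^ 2)) :
    (∑ m : Fin 2 → ZMod L, if m ≠ 0 ∧ momentumNormSq L m ≤ ε ^ 2 then
        pairStructureFactor dWaveFormFactor L ψ m else 0) ≤ η * (L : ℝ) ^ 2 := by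
  set H := hubbardTorus 2 L 1 U with hHdef
  set S := szSector (Λ := FermionTorus 2 L) (2 * n) 0 with hSdef
  set W : Matrix (Finset (Orb (FermionTorus 2 L))) (Finset (Orb (FermionTorus 2 L))) ℂ :=
    ∑ m : Fin 2 → ZMod L, if m ≠ 0 ∧ momentumNormSq L m ≤ ε ^ 2 then
      ((L : ℂ) ^ 2)⁻¹ • ((pairFieldAt dWaveFormFactor L m)ᴴ * pairFieldAt dWaveFormFactor L m)
      else 0 with hWdef
  set PS := projMatrix (S.map (Fock.toEuclidean (ι := Orb (FermionTorus 2 L)) :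
    Fock (Orb (FermionTorus 2 L)) →ₗ[ℂ] EuclideanSpace ℂ (Finset (Orb (FermionTorus 2 L)))))
    with hPSdef
  have hH : H.IsHermitian := LiebThm1.hamiltonian_isHermitian (fermionTorusGraph 2 L) 1 U
  have hW : W.IsHermitian := openWindowReward_isHermitian L ε
  have hA : (-W).IsHermitian := hW.neg
  have hinv : ∀ v ∈ S, H *ᵥ v ∈ S := fun v hv => szSector_invariant_hubbardTorus 2 L 1 U _ hv
  obtain ⟨hmem, hne, heig⟩ := hψ
  -- the reward as a penalty by `A = -W'`: `H - λ W' = H + λ (-W')`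
  have hHA : H - (lam : ℂ) • W = H + (lam : ℂ) • (-W) := by rw [smul_neg, sub_eq_add_neg]
  rw [hHA] at hchord
  -- the one-vector Peierls–Bogoliubov inequality with the entropy budget `log dim S`
  -- (`Fock.toEuclidean` is definitionally `(WithLp.linearEquiv 2 ℂ _).symm`, so the ascription holds)
  have h : (Real.log (PS * gibbsWeight β H).trace.re -
      Real.log (PS * gibbsWeight β (H + (lam : ℂ) • (-W))).trace.re -
      Real.log (Module.finrank ℂ S)) / (β * lam) ≤ (star ψ ⬝ᵥ (-W) *ᵥ ψ).re :=
    Theorems.thermalChord_le_re_rayleigh hH hA S hinv hmem hψ1 heig hlam hβ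
  have hWexp : (star ψ ⬝ᵥ (-W) *ᵥ ψ).re = -∑ m : Fin 2 → ZMod L,
      if m ≠ 0 ∧ momentumNormSq L m ≤ ε ^ 2 then pairStructureFactor dWaveFormFactor L ψ m else 0 := by
    rw [neg_mulVec, dotProduct_neg, Complex.neg_re, hWdef]
    exact congrArg Neg.neg (re_expect_openWindowReward L ε ψ)
  rw [hWexp] at h
  -- `1 ≤ dim S ≤ 4^{L²}`
  have hd1 : (1 : ℝ) ≤ Module.finrank ℂ S := by
    have : 0 < Module.finrank ℂ S := Module.finrank_pos_iff_exists_ne_zero.mpr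
      ⟨⟨ψ, hmem⟩, fun h0 => hne (by simpa using congrArg Subtype.val h0)⟩
    exact_mod_cast this
  have hbudget : Real.log (Module.finrank ℂ S) ≤ (L : ℝ) ^ 2 * Real.log 4 := by
    have h4 : (Module.finrank ℂ S : ℝ) ≤ (4 : ℝ) ^ (L ^ 2) := by
      exact_mod_cast Theorems.finrank_szSector_fermionTorus_le L (2 * n) 0
    calc Real.log (Module.finrank ℂ S) ≤ Real.log ((4 : ℝ) ^ (L ^ 2)) :=
          Real.log_le_log (by linarith) h4
      _ = (L : ℝ) ^ 2 * Real.log 4 := by rw [Real.log_pow]; push_cast; ring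
  rw [div_le_iff₀ (by positivity)] at h
  -- assemble: `-β λ Σ' ≥ log Z(H) - log Z(H - λW') - log dim ≥ log Z(H) - log Z(H - λW') - L² log 4 ≥ -β λ η L²`
  have hβlam : 0 < β * lam := mul_pos hβ hlam
  have key : β * lam * ∑ m : Fin 2 → ZMod L,
      (if m ≠ 0 ∧ momentumNormSq L m ≤ ε ^ 2 then pairStructureFactor dWaveFormFactor L ψ m else 0) ≤
      β * lam * (η * (L : ℝ) ^ 2) := by
    nlinarith [h, hbudget, hchord]
  exact le_of_mul_le_mul_left key hβlam

/-! ### The edge: thermal reward chords at weak coupling imply the crux -/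

/-- **The engine-facing re-cut of crux r3: thermal reward chords imply `NoInfraredPileUp`.** If for
every doping `δ ∈ (0,1/2)` there is `U₁ > 0` such that for all `U ∈ (0,U₁)` and every `η > 0` some
window radius `ε > 0` and threshold `L₀` have, at every even side `L ≥ L₀`, SOME reward strength
`λ > 0` and SOME inverse temperature `β > 0` with
`log re tr (P_{K_L} e^{-β(H_L − λ W'_ε)}) − log re tr (P_{K_L} e^{-βH_L}) + L² log 4 ≤ β λ η L²`
(`H_L = hubbardTorus 2 L 1 U`, `K_L = szSector N_L 0`, `N_L = 2⌊(1−δ)L²/2⌋`,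
`W'_ε = Σ_{m ≠ 0, |q_m| ≤ ε} L⁻² Δ_d(m)ᴴ Δ_d(m)`), then `NoInfraredPileUp`:
`windowCeiling_of_thermalRewardChord` at each side. The hypothesis is a bound on the response of a
sector free energy to an (intensive, `λ = κ₀/L²`) infrared pair REWARD — the generating-function
object of finite-temperature constructions — and it is uniform over the ground multiplet by itself.
(Sub-goal `stub_thermalRewardChordTransfer` registered on the item; statement on one line, verbatim
the registered text.) B. Simon (1993) §II.13; Pitaevskii–Stringari, JLTP 85 (1991) 377. [folklore] -/
theorem stub_thermalRewardChordTransfer :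
    (∀ δ ∈ Set.Ioo (0:ℝ) (1 / 2), ∃ U₁ : ℝ, 0 < U₁ ∧ ∀ U ∈ Set.Ioo (0:ℝ) U₁, ∀ η : ℝ, 0 < η → ∃ ε : ℝ, 0 < ε ∧ ∃ L₀ : ℕ, ∀ (L : ℕ) [NeZero L], Even L → L₀ ≤ L → ∃ lam : ℝ, 0 < lam ∧ ∃ β : ℝ, 0 < β ∧ Real.log (projMatrix ((szSector (Λ := FermionTorus 2 L) (2 * ⌊(1 - δ) * (L : ℝ) ^ 2 / 2⌋₊) 0).map (Fock.toEuclidean (ι := Orb (FermionTorus 2 L)) : Fock (Orb (FermionTorus 2 L)) →ₗ[ℂ] EuclideanSpace ℂ (Finset (Orb (FermionTorus 2 L))))) * gibbsWeight β (hubbardTorus 2 L 1 U - (lam : ℂ) • ∑ m : Fin 2 → ZMod L, if m ≠ 0 ∧ momentumNormSq L m ≤ ε ^ 2 then ((L : ℂ) ^ 2)⁻¹ • ((pairFieldAt dWaveFormFactor L m)ᴴ * pairFieldAt dWaveFormFactor L m) else 0)).trace.re - Real.log (projMatrix ((szSector (Λ := FermionTorus 2 L) (2 * ⌊(1 - δ)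 * (L : ℝ) ^ 2 / 2⌋₊) 0).map (Fock.toEuclidean (ι := Orb (FermionTorus 2 L)) : Fock (Orb (FermionTorus 2 L)) →ₗ[ℂ] EuclideanSpace ℂ (Finset (Orb (FermionTorus 2 L))))) * gibbsWeight β (hubbardTorus 2 L 1 U)).trace.re + (L : ℝ) ^ 2 * Real.log 4 ≤ β * lam * (η * (L : ℝ) ^ 2)) → Summit.HubbardSuperconductivity.HubbardSuperconductivity.Theses.InfiniteVolumeFirst.NoInfraredPileUp := by
  intro hth δ hδ
  obtain ⟨U₁, hU₁, hall⟩ := hth δ hδ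
  refine ⟨U₁, hU₁, fun U hU N ψ hadm η hη => ?_⟩
  obtain ⟨ε, hε, L₀, hL₀⟩ := hall U hU η hη
  refine ⟨ε, hε, L₀, fun L _ hLe hLge => ?_⟩
  obtain ⟨lam, hlam, β, hβ, hchord⟩ := hL₀ L hLe hLge
  obtain ⟨hN, hψ1, hgs⟩ := hadm L hLe
  rw [hN] at hgs
  exact windowCeiling_of_thermalRewardChord L U ε hlam hβ _ hψ1 hgs hchord

/-! ### The zero-temperature version: reward stability of the sector ground-state energy -/

/-- **Every sector ground state is tight, from reward stability at `T = 0`.** If the reward `−λ W'_ε`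
(`λ > 0`) lowers the sector ground-state energy by at most `λ η L²`,
`minEnergyOn H K − minEnergyOn (H − λ W'_ε) K ≤ λ (η L²)` (`K = szSector N 0`), then every
normalised ground state `ψ` of `H = hubbardTorus 2 L 1 U` in `K` has
`Σ_{m ≠ 0, |q_m| ≤ ε} S_ψ(m) ≤ η L²` — the chord inequality `chord_div_le_re_expect_of_eigen` for the
pencil `H + λ(−W'_ε)` and `re_expect_openWindowReward`. Equivalently: every state `φ ∈ K` obeys
`λ Σ' S_φ ≤ λ η L² + (⟨φ, Hφ⟩ − e₀)`, a tightness-versus-excitation-energy trade-off.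
Tasaki (2020) §2.1; Pitaevskii–Stringari, JLTP 85 (1991) 377. [folklore] -/
theorem windowCeiling_of_rewardStability (L : ℕ) [NeZero L] (U ε : ℝ) {lam η : ℝ} (hlam : 0 < lam)
    (N : ℕ) {ψ : Fock (Orb (FermionTorus 2 L))} (hψ1 : star ψ ⬝ᵥ ψ = 1)
    (hψ : IsGroundStateInSector (hubbardTorus 2 L 1 U) N 0 ψ)
    (hstab : (hubbardTorus 2 L 1 U).minEnergyOn (szSector N 0) -
      (hubbardTorus 2 L 1 U - (lam : ℂ) • ∑ m : Fin 2 → ZMod L,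
          if m ≠ 0 ∧ momentumNormSq L m ≤ ε ^ 2 then
            ((L : ℂ) ^ 2)⁻¹ • ((pairFieldAt dWaveFormFactor L m)ᴴ * pairFieldAt dWaveFormFactor L m)
          else 0).minEnergyOn (szSector N 0) ≤ lam * (η * (L : ℝ) ^ 2)) :
    (∑ m : Fin 2 → ZMod L, if m ≠ 0 ∧ momentumNormSq L m ≤ ε ^ 2 then
        pairStructureFactor dWaveFormFactor L ψ m else 0) ≤ η * (L : ℝ) ^ 2 := by
  set H := hubbardTorus 2 L 1 U with hHdef
  set W : Matrix (Finset (Orb (FermionTorus 2 L))) (Finset (Orb (FermionTorus 2 L))) ℂ :=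
    ∑ m : Fin 2 → ZMod L, if m ≠ 0 ∧ momentumNormSq L m ≤ ε ^ 2 then
      ((L : ℂ) ^ 2)⁻¹ • ((pairFieldAt dWaveFormFactor L m)ᴴ * pairFieldAt dWaveFormFactor L m)
      else 0 with hWdef
  obtain ⟨hmem, -, heig⟩ := hψ
  have hHA : H - (lam : ℂ) • W = H + (lam : ℂ) • (-W) := by rw [smul_neg, sub_eq_add_neg]
  rw [hHA] at hstab
  have hch := chord_div_le_re_expect_of_eigen H (-W) (szSector N 0) hlam hmem hψ1 heig
  have hWexp : (star ψ ⬝ᵥ (-W) *ᵥ ψ).re = -∑ m : Fin 2 → ZMod L,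
      if m ≠ 0 ∧ momentumNormSq L m ≤ ε ^ 2 then pairStructureFactor dWaveFormFactor L ψ m else 0 := by
    rw [neg_mulVec, dotProduct_neg, Complex.neg_re, hWdef]
    exact congrArg Neg.neg (re_expect_openWindowReward L ε ψ)
  rw [hWexp, div_le_iff₀ hlam] at hch
  have key : lam * ∑ m : Fin 2 → ZMod L,
      (if m ≠ 0 ∧ momentumNormSq L m ≤ ε ^ 2 then pairStructureFactor dWaveFormFactor L ψ m else 0) ≤
      lam * (η * (L : ℝ) ^ 2) := by
    nlinarith [hch, hstab]
  exact le_of_mul_le_mul_left key hlam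

/-- **Reward stability at `T = 0`, at weak coupling, implies `NoInfraredPileUp`.** If for every
`δ ∈ (0,1/2)` there is `U₁ > 0` such that for all `U ∈ (0,U₁)` and every `η > 0` some `ε > 0` and `L₀`
have, at every even side `L ≥ L₀`, SOME `λ > 0` with
`minEnergyOn H_L K_L − minEnergyOn (H_L − λ W'_ε) K_L ≤ λ η L²`, then the crux holds
(`windowCeiling_of_rewardStability` at each side). As for the thermal form, only an intensive reward
`λ = κ₀/L²` with `κ₀` below the stiffness scale can be true in a superconducting phase
(`Negative/NearGroundStates`). (Sub-goal `stub_rewardStabilityTransfer` registered on the item;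
statement on one line, verbatim the registered text.) Tasaki (2020) §2.1. [folklore] -/
theorem stub_rewardStabilityTransfer :
    (∀ δ ∈ Set.Ioo (0:ℝ) (1 / 2), ∃ U₁ : ℝ, 0 < U₁ ∧ ∀ U ∈ Set.Ioo (0:ℝ) U₁, ∀ η : ℝ, 0 < η → ∃ ε : ℝ, 0 < ε ∧ ∃ L₀ : ℕ, ∀ (L : ℕ) [NeZero L], Even L → L₀ ≤ L → ∃ lam : ℝ, 0 < lam ∧ (hubbardTorus 2 L 1 U).minEnergyOn (szSector (Λ := FermionTorus 2 L) (2 * ⌊(1 - δ) * (L : ℝ) ^ 2 / 2⌋₊) 0) - (hubbardTorus 2 L 1 U - (lam : ℂ) • ∑ m : Fin 2 → ZMod L, if m ≠ 0 ∧ momentumNormSq L m ≤ ε ^ 2 then ((L : ℂ) ^ 2)⁻¹ • ((pairFieldAt dWaveFormFactor L m)ᴴ * pairFieldAt dWaveFormFactor L m) else 0).minEnergyOn (szSector (Λ := FermionTorus 2 L) (2 * ⌊(1 - δ) * (L : ℝ) ^ 2 / 2⌋₊) 0) ≤ lam * (η * (L : ℝ) ^ 2)) → Summit.HubbardSuperconductivity.HubbardSuperconductivity.Theses.InfiniteVolumeFirst.NoInfraredPileUp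 := by
  intro hst δ hδ
  obtain ⟨U₁, hU₁, hall⟩ := hst δ hδ
  refine ⟨U₁, hU₁, fun U hU N ψ hadm η hη => ?_⟩
  obtain ⟨ε, hε, L₀, hL₀⟩ := hall U hU η hη
  refine ⟨ε, hε, L₀, fun L _ hLe hLge => ?_⟩
  obtain ⟨lam, hlam, hstab⟩ := hL₀ L hLe hLge
  obtain ⟨hN, hψ1, hgs⟩ := hadm L hLe
  rw [hN] at hgs
  exact windowCeiling_of_rewardStability L U ε hlam _ hψ1 hgs hstab

end Summit.HubbardSuperconductivity.HubbardSuperconductivity.Theorems.NoInfraredPileUp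

end
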